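import Mathlib

/-!
# Hodge-locus census — terminal facts of LEMMA GQ and LEMMA G4 (PROPOSITION D3-II, the c′ = 2 cubic cells)

certified instances and evidence bearing on the general Hodge conjecture; no claim.

Cell record: `HOME/pub-hlocus-ivhs-2/ENGINEB-g32.md` §13c (ENGINE B, gen 32).  In the cubic cells `(2p,3,p−2)`
(two `p`-planes meeting in a `ℙ^{p−2}`) the census column `b` equals `n₁(δ)` for the `2×2` determinant `δ` of
linear forms, and the values `b = 2`, `b = 1` are realised by explicit members built from the blocks
`Q := ab(a+b+x) + y(x²+y²)` and `G4 := ab(a+b+s) + Σ_{j=2..4} y_j(x_j²+y_j²)`, `s = x₂+x₃+x₄`.  Their smoothness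
(char 0) is a two-branch hand computation; this file kernel-checks the TERMINAL identities of the branch `ab ≠ 0`:

* `gq_branch2`  : `x + 3a = 0`, `6y − a = 0`, `x² + 3y² = 0` force `a = 0` (the identity `12(x²+3y²) = 109a²`);
* `g4_branch2_Z4` : `a ≠ 0`, `4ξ₄ = −3a⁴`, `ξ₄·Z₄ = 81a⁴` force `Z₄ = −108`;
* `sum3_pow4_mem` : for every sum `Z` of three fourth roots of unity, `Z⁴ ∈ {1, 81, −7+24i, −7−24i}` (so never `−108`),
  `no_Z4_eq_neg108`; computed on `ℤ × ℤ` with the Gaussian product written inline as `gmul'`/`gpow4'`/`gadd3'`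
  (`abbrev`s, definitionally the `gmul`/`gpow4`/`gadd3` of `Theorems/HodgeLocusCensusD3Blocks.lean`, whose `gmul_eq` identifies
  the product with `GaussianInt` multiplication; restated here as `gmul'_eq`);
* `bad_prime_norms` : the norms `N(Z⁴ + 108)` are `189² = 3⁶·7²`, `101² + 24² = 13·829`, `109²` — the predicted bad primes
  `{7, 13, 109, 829}` (plus 2, 3), at which the record's `F_p` sanity indeed finds singular points on this branch.

What is NOT formalised: the elimination from the gradient system to these hypotheses, the `n₁` counts, THEOREM K⁼.
-/

namespace Summit.HodgeConjecture.HodgeConjecture.HodgeLocus.Census.C2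

section FieldFacts

variable {K : Type*} [Field K] [CharZero K]

/-- LEMMA GQ, branch `ab ≠ 0`: with `x = −3a`, `y = a/6` the last partial `x² + 3y²` equals `(109/12)a²`,
so its vanishing forces `a = 0`. -/
theorem gq_branch2 (a x y : K) (hx : x + 3 * a = 0) (hy : 6 * y - a = 0) (h : x ^ 2 + 3 * y ^ 2 = 0) :
    a = 0 := by
  have h109 : (109 : K) * a ^ 2 = 0 := by
    linear_combination (-12 * (x - 3 * a)) * hx - (6 * y + a) * hy + 12 * h
  have : a ^ 2 = 0 := by
    rcases mul_eq_zero.mp h109 with h0 | h0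
    · norm_num at h0
    · exact h0
  exact pow_eq_zero_iff (n := 2) (by norm_num) |>.mp this

/-- LEMMA G4, branch `ab ≠ 0`: `4ξ₄ = −3a⁴` (`ξ₄ = x_j⁴`) and `ξ₄ Z₄ = s⁴ = 81a⁴` with `a ≠ 0` force `Z₄ = −108`. -/
theorem g4_branch2_Z4 (a ξ4 Z4 : K) (ha : a ≠ 0) (hξ : 4 * ξ4 = -3 * a ^ 4) (hs : ξ4 * Z4 = 81 * a ^ 4) :
    Z4 = -108 := by
  have h1 : a ^ 4 * (3 * Z4 + 324) = 0 := by
    linear_combination Z4 * hξ - 4 * hs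
  have h2 : 3 * Z4 + 324 = 0 := by
    rcases mul_eq_zero.mp h1 with h0 | h0
    · exact absurd (pow_eq_zero_iff (n := 4) (by norm_num) |>.mp h0) ha
    · exact h0
  linear_combination h2 / 3

end FieldFacts

section GaussianFacts

/-- The four fourth roots of unity of `ℤ[i]` as pairs `(Re, Im)`. -/
abbrev U4' : List (ℤ × ℤ) := [(1, 0), (-1, 0), (0, 1), (0, -1)]

/-- Gaussian product on `ℤ × ℤ`. -/
abbrev gmul' (z w : ℤ × ℤ) : ℤ × ℤ := (z.1 * w.1 - z.2 * w.2, z.1 * w.2 + z.2 * w.1)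

/-- Sum of three Gaussian integers (as pairs). -/
abbrev gadd3' (u v w : ℤ × ℤ) : ℤ × ℤ := (u.1 + v.1 + w.1, u.2 + v.2 + w.2)

/-- Fourth power for the Gaussian product `gmul'`. -/
abbrev gpow4' (z : ℤ × ℤ) : ℤ × ℤ := gmul' (gmul' z z) (gmul' z z)

/-- `gmul'` is `GaussianInt` multiplication coordinatewise. -/
theorem gmul'_eq (z w : GaussianInt) :
    gmul' (z.re, z.im) (w.re, w.im) = ((z * w).re, (z * w).im) := by
  refine Prod.ext ?_ ?_
  · simp [Zsqrtd.re_mul]; ring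
  · simp [Zsqrtd.im_mul]

/-- Every sum `Z` of three fourth roots of unity has `Z⁴ ∈ {1, 81, −7 + 24i, −7 − 24i}`. -/
theorem sum3_pow4_mem : ∀ u ∈ U4', ∀ v ∈ U4', ∀ w ∈ U4',
    gpow4' (gadd3' u v w) ∈ [((1 : ℤ), (0 : ℤ)), (81, 0), (-7, 24), (-7, -24)] := by
  decide

/-- Hence `Z⁴ = −108` is impossible (LEMMA G4, end of branch `ab ≠ 0`). -/
theorem no_Z4_eq_neg108 : ∀ u ∈ U4', ∀ v ∈ U4', ∀ w ∈ U4', gpow4' (gadd3' u v w) ≠ (-108, 0) := by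
  decide

/-- The norms `N(Z⁴ + 108)` for the four possible values of `Z⁴`, factored: the bad primes of LEMMA G4, branch 2. -/
theorem bad_prime_norms :
    (81 + 108 : ℤ) ^ 2 = 3 ^ 6 * 7 ^ 2 ∧ ((-7 + 108 : ℤ) ^ 2 + 24 ^ 2 = 13 * 829) ∧ ((1 + 108 : ℤ) ^ 2 = 109 ^ 2) := by
  norm_num

end GaussianFacts

end Summit.HodgeConjecture.HodgeConjecture.HodgeLocus.Census.C2
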